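import Literature.AlgebraicGeometry.HodgeTheory.CMHodgeGroupDerivedAlgebra
import Literature.Algebra.Lie.IrreducibleLinearLieAlgebraSpaceThree
import HarnessLib

/-!
# The complex derived span of a bracket-closed `𝔤` projects onto `𝔰𝔩(W)` for a `𝔤`-irreducible `3`-space `W` carrying an
# element of `𝔤_ℂ` of eigenvalue signature `(2,1)` (Moonen–Zarhin 1999 (2.3), the case `dim_E H¹ = 3`)

Family `hodge`, layer `Literature/AlgebraicGeometry/HodgeTheory` (cell `pub-hodgeav-hg6`, req-37 (A) Q2b, TABLE X ROW 10 — `End⁰ = E`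
a quartic CM field, `dim_E H¹ = 3` — brick (d) of the eng-5 g6 plan; companion of `CMHodgeGroupDerivedAlgebra` §3, the
`dim W = 2` case). UNCONDITIONAL; theorems only, no definition, no named fact, no `sorry`. HONEST FRAMING of that cell:
HC / HC_AV / HC_CM / H2 NOT proved; this is one linear-algebra input of the LIFT step for row 10, nothing more.

* `CMDerived.trace_unit_eq_zero` — the off-diagonal matrix units `b_i ⊗ b_j^*` (`i ≠ j`) of a basis are traceless.
* **`CMDerived.exists_mem_spanC_derived_forall_eq_three`** — for `𝔤 ⊆ End_ℚ(V)` bracket-closed, `W ⊆ V_ℂ` a `𝔤`-stable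
  `𝔤`-irreducible subspace with a basis `b : Fin 3 → W`, and `D ∈ 𝔤_ℂ` with `D b₀ = β b₀`, `D b₁ = α b₁`, `D b₂ = α b₂`,
  `α ≠ β` (the Hodge operator `Θ` on an eigenspace `W_σ` of signature `(2,1)` / `(1,2)`): every traceless endomorphism of
  `W` is induced by an element of the complex span of the DERIVED set `{XX' − X'X}` of `𝔤` — by the tree's relative
  `𝔰𝔩₃` theorem `Literature.Algebra.Lie.exists_mem_forall_eq_of_trace_eq_zero_three` (every traceless endomorphism of
  `W` lifts to `𝔤_ℂ`) and the perfectness of `𝔰𝔩₃` written in matrix units (`E_{ij} = [E_{ik}, E_{kj}]`,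
  `E_{ii} − E_{00} = [E_{i0}, E_{0i}]`).

## References
* [MoonenZarhin1999LowDim] B. Moonen, Yu. Zarhin, Math. Ann. 315 (1999), §2 (2.3).
* [Humphreys1972] J. E. Humphreys, GTM 9, §1.2 (the basis `e_{ij}` of `𝔤𝔩`, `𝔰𝔩(ℓ+1)`), §4.1.
-/

open scoped TensorProduct
open Module

namespace Literature.AlgebraicGeometry.Motives

namespace HodgeStructure

universe u

variable {V : Type u} [AddCommGroup V] [Module ℚ V]

section Units

variable {W : Type*} [AddCommGroup W] [Module ℂ W]

/-- `E_{ij} b_j = b_i`. [folklore] -/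
private theorem unit_apply_self' (b : Basis (Fin 3) ℂ W) (i j : Fin 3) :
    ((b.coord j).smulRight (b i)) (b j) = b i := by
  rw [LinearMap.smulRight_apply, Basis.coord_apply, Basis.repr_self, Finsupp.single_eq_same, one_smul]

/-- `E_{ij} b_k = 0` for `k ≠ j`. [folklore] -/
private theorem unit_apply_ne' (b : Basis (Fin 3) ℂ W) (i : Fin 3) {j k : Fin 3} (hjk : j ≠ k) :
    ((b.coord j).smulRight (b i)) (b k) = 0 := by
  rw [LinearMap.smulRight_apply, Basis.coord_apply, Basis.repr_self, Finsupp.single_eq_of_ne hjk, zero_smul]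

/-- `E_{ij} E_{jl} = E_{il}`. [folklore] -/
private theorem unit_mul_unit_self' (b : Basis (Fin 3) ℂ W) (i j l : Fin 3) :
    (b.coord j).smulRight (b i) * (b.coord l).smulRight (b j) = (b.coord l).smulRight (b i) := by
  refine b.ext fun k => ?_
  rw [Module.End.mul_apply]
  by_cases hlk : l = k
  · subst hlk
    rw [unit_apply_self', unit_apply_self', unit_apply_self']
  · rw [unit_apply_ne' b j hlk, unit_apply_ne' b i hlk, map_zero]

/-- `E_{ij} E_{kl} = 0` for `j ≠ k`. [folklore] -/
private theorem unit_mul_unit_ne' (b : Basis (Fin 3) ℂ W) (i : Fin 3) {j k : Fin 3} (hjk : j ≠ k) (l : Fin 3) :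
    (b.coord j).smulRight (b i) * (b.coord l).smulRight (b k) = 0 := by
  refine b.ext fun m => ?_
  rw [Module.End.mul_apply, LinearMap.zero_apply]
  by_cases hlm : l = m
  · subst hlm
    rw [unit_apply_self', unit_apply_ne' b i hjk]
  · rw [unit_apply_ne' b k hlm, map_zero]

/-- **The off-diagonal matrix units are traceless**: `tr(b_i ⊗ b_j^*) = 0` for `i ≠ j`. [cite: Humphreys1972, §1.2] -/
theorem CMDerived.trace_unit_eq_zero (b : Basis (Fin 3) ℂ W) {i j : Fin 3} (hij : i ≠ j) :
    LinearMap.trace ℂ W ((b.coord j).smulRight (b i)) = 0 := by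
  rw [Literature.Algebra.Lie.trace_eq_sum_repr b]
  refine Finset.sum_eq_zero fun k _ => ?_
  by_cases hjk : j = k
  · subst hjk
    rw [unit_apply_self', Basis.repr_self, Finsupp.single_eq_of_ne hij.symm]
  · rw [unit_apply_ne' b i hjk, map_zero, Finsupp.zero_apply]

end Units

/-- **Every traceless endomorphism of a `𝔤`-irreducible `𝔤`-stable `3`-space `W ⊆ V_ℂ` carrying an element `D ∈ 𝔤_ℂ` of
eigenvalue signature `(2,1)` is induced by the complex DERIVED span** of the bracket-closed `𝔤`: the relative `𝔰𝔩₃`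
theorem lifts the six off-diagonal matrix units of a `D`-adapted basis to `𝔤_ℂ`, and `Z = Σ_{i≠j} z_{ij}[E_{ik}, E_{kj}] +
z₁₁[E₁₀, E₀₁] + z₂₂[E₂₀, E₀₂]` (`tr Z = 0`) moves `Z` into the span of commutators.
[cite: MoonenZarhin1999LowDim, §2 (2.3)] [cite: Humphreys1972, §1.2 and §4.1] -/
theorem CMDerived.exists_mem_spanC_derived_forall_eq_three [Module.Finite ℚ V] (𝔤 : Submodule ℚ (Module.End ℚ V))
    (hbr : ∀ X ∈ 𝔤, ∀ X' ∈ 𝔤, X * X' - X' * X ∈ 𝔤) (W : Submodule ℂ (ℂ ⊗[ℚ] V)) (bW : Basis (Fin 3) ℂ ↥W)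
    (hW : ∀ X ∈ 𝔤, ∀ w ∈ W, X.baseChange ℂ w ∈ W)
    (hirr : ∀ U ≤ W, (∀ X ∈ 𝔤, ∀ u ∈ U, X.baseChange ℂ u ∈ U) → U = ⊥ ∨ U = W)
    {D : Module.End ℂ (ℂ ⊗[ℚ] V)} (hD : D ∈ spanC 𝔤) {α β : ℂ} (hαβ : α ≠ β)
    (hD0 : D (bW 0 : ↥W) = β • (bW 0 : ℂ ⊗[ℚ] V)) (hD1 : D (bW 1 : ↥W) = α • (bW 1 : ℂ ⊗[ℚ] V))
    (hD2 : D (bW 2 : ↥W) = α • (bW 2 : ℂ ⊗[ℚ] V))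
    (Z : Module.End ℂ ↥W) (hZ : LinearMap.trace ℂ _ Z = 0) :
    ∃ Y ∈ spanC (Submodule.span ℚ {B | ∃ X ∈ 𝔤, ∃ X' ∈ 𝔤, X * X' - X' * X = B}), ∀ w : ↥W, Y w = Z w := by
  classical
  -- the relative `𝔰𝔩₃` theorem for `𝔤_ℂ` on `W`
  have hSW : ∀ Y ∈ spanC 𝔤, ∀ w ∈ W, Y w ∈ W := fun Y hY w hw =>
    mapsTo_of_mem_spanC (T := W) (fun X hX => fun w hw => hW X hX w hw) hY hw
  have hbrC : ∀ Y ∈ spanC 𝔤, ∀ Y' ∈ spanC 𝔤, Y * Y' - Y' * Y ∈ spanC 𝔤 := fun Y hY Y' hY' =>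
    commutator_mem_spanC hbr hY hY'
  have hirrC : ∀ U ≤ W, (∀ Y ∈ spanC 𝔤, ∀ u ∈ U, Y u ∈ U) → U = ⊥ ∨ U = W := fun U hU hst =>
    hirr U hU fun X hX u hu => hst _ (baseChange_mem_spanC hX) u hu
  have hlift : ∀ T : Module.End ℂ ↥W, LinearMap.trace ℂ _ T = 0 → ∃ Y ∈ spanC 𝔤, ∀ w : ↥W, (T w : ℂ ⊗[ℚ] V) = Y w :=
    fun T hT => Literature.Algebra.Lie.exists_mem_forall_eq_of_trace_eq_zero_three W bW (spanC 𝔤) hbrC hSW hirrC hD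
      hαβ hD0 hD1 hD2 hT
  have h01 : (0 : Fin 3) ≠ 1 := by decide
  have h02 : (0 : Fin 3) ≠ 2 := by decide
  have h10 : (1 : Fin 3) ≠ 0 := by decide
  have h12 : (1 : Fin 3) ≠ 2 := by decide
  have h20 : (2 : Fin 3) ≠ 0 := by decide
  have h21 : (2 : Fin 3) ≠ 1 := by decide
  -- `Z` in matrix units (with `z₀₀ = −z₁₁ − z₂₂`)
  have htr : bW.repr (Z (bW 0)) 0 + bW.repr (Z (bW 1)) 1 + bW.repr (Z (bW 2)) 2 = 0 := by
    rw [Literature.Algebra.Lie.trace_eq_sum_repr bW, Fin.sum_univ_three] at hZ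
    exact hZ
  have hZunits : Z = bW.repr (Z (bW 0)) 1 • (bW.coord 0).smulRight (bW 1) +
      bW.repr (Z (bW 0)) 2 • (bW.coord 0).smulRight (bW 2) +
      bW.repr (Z (bW 1)) 0 • (bW.coord 1).smulRight (bW 0) + bW.repr (Z (bW 2)) 0 • (bW.coord 2).smulRight (bW 0) +
      bW.repr (Z (bW 1)) 1 • ((bW.coord 1).smulRight (bW 1) - (bW.coord 0).smulRight (bW 0)) +
      bW.repr (Z (bW 2)) 2 • ((bW.coord 2).smulRight (bW 2) - (bW.coord 0).smulRight (bW 0)) +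
      bW.repr (Z (bW 2)) 1 • (bW.coord 2).smulRight (bW 1) + bW.repr (Z (bW 1)) 2 • (bW.coord 1).smulRight (bW 2) := by
    have h00 : bW.repr (Z (bW 0)) 0 = -bW.repr (Z (bW 1)) 1 - bW.repr (Z (bW 2)) 2 := by linear_combination htr
    conv_lhs => rw [Literature.Algebra.Lie.eq_sum_units bW Z, Fin.sum_univ_three, Fin.sum_univ_three, Fin.sum_univ_three,
      Fin.sum_univ_three, h00]
    module
  -- the matrix units as commutators of off-diagonal units
  have c10 : (bW.coord 2).smulRight (bW 1) * (bW.coord 0).smulRight (bW 2) -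
      (bW.coord 0).smulRight (bW 2) * (bW.coord 2).smulRight (bW 1) = (bW.coord 0).smulRight (bW 1) := by
    rw [unit_mul_unit_self', unit_mul_unit_ne' bW 2 h01]
    exact sub_zero ((bW.coord 0).smulRight (bW 1) : Module.End ℂ ↥W)
  have c20 : (bW.coord 1).smulRight (bW 2) * (bW.coord 0).smulRight (bW 1) -
      (bW.coord 0).smulRight (bW 1) * (bW.coord 1).smulRight (bW 2) = (bW.coord 0).smulRight (bW 2) := by
    rw [unit_mul_unit_self', unit_mul_unit_ne' bW 1 h02]
    exact sub_zero ((bW.coord 0).smulRight (bW 2) : Module.End ℂ ↥W)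
  have c01 : (bW.coord 2).smulRight (bW 0) * (bW.coord 1).smulRight (bW 2) -
      (bW.coord 1).smulRight (bW 2) * (bW.coord 2).smulRight (bW 0) = (bW.coord 1).smulRight (bW 0) := by
    rw [unit_mul_unit_self', unit_mul_unit_ne' bW 2 h10]
    exact sub_zero ((bW.coord 1).smulRight (bW 0) : Module.End ℂ ↥W)
  have c02 : (bW.coord 1).smulRight (bW 0) * (bW.coord 2).smulRight (bW 1) -
      (bW.coord 2).smulRight (bW 1) * (bW.coord 1).smulRight (bW 0) = (bW.coord 2).smulRight (bW 0) := by
    rw [unit_mul_unit_self', unit_mul_unit_ne' bW 1 h20]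
    exact sub_zero ((bW.coord 2).smulRight (bW 0) : Module.End ℂ ↥W)
  have c12 : (bW.coord 0).smulRight (bW 1) * (bW.coord 2).smulRight (bW 0) -
      (bW.coord 2).smulRight (bW 0) * (bW.coord 0).smulRight (bW 1) = (bW.coord 2).smulRight (bW 1) := by
    rw [unit_mul_unit_self', unit_mul_unit_ne' bW 0 h21]
    exact sub_zero ((bW.coord 2).smulRight (bW 1) : Module.End ℂ ↥W)
  have c21 : (bW.coord 0).smulRight (bW 2) * (bW.coord 1).smulRight (bW 0) -
      (bW.coord 1).smulRight (bW 0) * (bW.coord 0).smulRight (bW 2) = (bW.coord 1).smulRight (bW 2) := by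
    rw [unit_mul_unit_self', unit_mul_unit_ne' bW 0 h12]
    exact sub_zero ((bW.coord 1).smulRight (bW 2) : Module.End ℂ ↥W)
  have c11 : (bW.coord 0).smulRight (bW 1) * (bW.coord 1).smulRight (bW 0) -
      (bW.coord 1).smulRight (bW 0) * (bW.coord 0).smulRight (bW 1) =
      (bW.coord 1).smulRight (bW 1) - (bW.coord 0).smulRight (bW 0) := by
    rw [unit_mul_unit_self', unit_mul_unit_self']
  have c22 : (bW.coord 0).smulRight (bW 2) * (bW.coord 2).smulRight (bW 0) -
      (bW.coord 2).smulRight (bW 0) * (bW.coord 0).smulRight (bW 2) =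
      (bW.coord 2).smulRight (bW 2) - (bW.coord 0).smulRight (bW 0) := by
    rw [unit_mul_unit_self', unit_mul_unit_self']
  -- lift the six off-diagonal units
  obtain ⟨Y10, hY10, hY10w⟩ := hlift _ (CMDerived.trace_unit_eq_zero bW h10)
  obtain ⟨Y20, hY20, hY20w⟩ := hlift _ (CMDerived.trace_unit_eq_zero bW h20)
  obtain ⟨Y01, hY01, hY01w⟩ := hlift _ (CMDerived.trace_unit_eq_zero bW h01)
  obtain ⟨Y02, hY02, hY02w⟩ := hlift _ (CMDerived.trace_unit_eq_zero bW h02)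
  obtain ⟨Y12, hY12, hY12w⟩ := hlift _ (CMDerived.trace_unit_eq_zero bW h12)
  obtain ⟨Y21, hY21, hY21w⟩ := hlift _ (CMDerived.trace_unit_eq_zero bW h21)
  -- `Z` as a combination of commutators of off-diagonal units
  have key : Z = bW.repr (Z (bW 0)) 1 • ((bW.coord 2).smulRight (bW 1) * (bW.coord 0).smulRight (bW 2) -
        (bW.coord 0).smulRight (bW 2) * (bW.coord 2).smulRight (bW 1)) +
      bW.repr (Z (bW 0)) 2 • ((bW.coord 1).smulRight (bW 2) * (bW.coord 0).smulRight (bW 1) -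
        (bW.coord 0).smulRight (bW 1) * (bW.coord 1).smulRight (bW 2)) +
      bW.repr (Z (bW 1)) 0 • ((bW.coord 2).smulRight (bW 0) * (bW.coord 1).smulRight (bW 2) -
        (bW.coord 1).smulRight (bW 2) * (bW.coord 2).smulRight (bW 0)) +
      bW.repr (Z (bW 2)) 0 • ((bW.coord 1).smulRight (bW 0) * (bW.coord 2).smulRight (bW 1) -
        (bW.coord 2).smulRight (bW 1) * (bW.coord 1).smulRight (bW 0)) +
      bW.repr (Z (bW 1)) 1 • ((bW.coord 0).smulRight (bW 1) * (bW.coord 1).smulRight (bW 0) -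
        (bW.coord 1).smulRight (bW 0) * (bW.coord 0).smulRight (bW 1)) +
      bW.repr (Z (bW 2)) 2 • ((bW.coord 0).smulRight (bW 2) * (bW.coord 2).smulRight (bW 0) -
        (bW.coord 2).smulRight (bW 0) * (bW.coord 0).smulRight (bW 2)) +
      bW.repr (Z (bW 2)) 1 • ((bW.coord 0).smulRight (bW 1) * (bW.coord 2).smulRight (bW 0) -
        (bW.coord 2).smulRight (bW 0) * (bW.coord 0).smulRight (bW 1)) +
      bW.repr (Z (bW 1)) 2 • ((bW.coord 0).smulRight (bW 2) * (bW.coord 1).smulRight (bW 0) -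
        (bW.coord 1).smulRight (bW 0) * (bW.coord 0).smulRight (bW 2)) := by
    rw [c10, c20, c01, c02, c11, c22, c12, c21]
    exact hZunits
  have hZeq : ∀ w : ↥W, Z w =
      bW.repr (Z (bW 0)) 1 • (((bW.coord 2).smulRight (bW 1)) (((bW.coord 0).smulRight (bW 2)) w) -
        ((bW.coord 0).smulRight (bW 2)) (((bW.coord 2).smulRight (bW 1)) w)) +
      bW.repr (Z (bW 0)) 2 • (((bW.coord 1).smulRight (bW 2)) (((bW.coord 0).smulRight (bW 1)) w) -
        ((bW.coord 0).smulRight (bW 1)) (((bW.coord 1).smulRight (bW 2)) w)) +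
      bW.repr (Z (bW 1)) 0 • (((bW.coord 2).smulRight (bW 0)) (((bW.coord 1).smulRight (bW 2)) w) -
        ((bW.coord 1).smulRight (bW 2)) (((bW.coord 2).smulRight (bW 0)) w)) +
      bW.repr (Z (bW 2)) 0 • (((bW.coord 1).smulRight (bW 0)) (((bW.coord 2).smulRight (bW 1)) w) -
        ((bW.coord 2).smulRight (bW 1)) (((bW.coord 1).smulRight (bW 0)) w)) +
      bW.repr (Z (bW 1)) 1 • (((bW.coord 0).smulRight (bW 1)) (((bW.coord 1).smulRight (bW 0)) w) -
        ((bW.coord 1).smulRight (bW 0)) (((bW.coord 0).smulRight (bW 1)) w)) +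
      bW.repr (Z (bW 2)) 2 • (((bW.coord 0).smulRight (bW 2)) (((bW.coord 2).smulRight (bW 0)) w) -
        ((bW.coord 2).smulRight (bW 0)) (((bW.coord 0).smulRight (bW 2)) w)) +
      bW.repr (Z (bW 2)) 1 • (((bW.coord 0).smulRight (bW 1)) (((bW.coord 2).smulRight (bW 0)) w) -
        ((bW.coord 2).smulRight (bW 0)) (((bW.coord 0).smulRight (bW 1)) w)) +
      bW.repr (Z (bW 1)) 2 • (((bW.coord 0).smulRight (bW 2)) (((bW.coord 1).smulRight (bW 0)) w) -
        ((bW.coord 1).smulRight (bW 0)) (((bW.coord 0).smulRight (bW 2)) w)) := fun w => by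
    conv_lhs => rw [key]
    rfl
  refine ⟨bW.repr (Z (bW 0)) 1 • (Y12 * Y20 - Y20 * Y12) + bW.repr (Z (bW 0)) 2 • (Y21 * Y10 - Y10 * Y21) +
      bW.repr (Z (bW 1)) 0 • (Y02 * Y21 - Y21 * Y02) + bW.repr (Z (bW 2)) 0 • (Y01 * Y12 - Y12 * Y01) +
      bW.repr (Z (bW 1)) 1 • (Y10 * Y01 - Y01 * Y10) + bW.repr (Z (bW 2)) 2 • (Y20 * Y02 - Y02 * Y20) +
      bW.repr (Z (bW 2)) 1 • (Y10 * Y02 - Y02 * Y10) + bW.repr (Z (bW 1)) 2 • (Y20 * Y01 - Y01 * Y20), ?_, fun w => ?_⟩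
  · refine Submodule.add_mem _ (Submodule.add_mem _ (Submodule.add_mem _ (Submodule.add_mem _ (Submodule.add_mem _
      (Submodule.add_mem _ (Submodule.add_mem _ (Submodule.smul_mem _ _ (commutator_mem_spanC_derived hY12 hY20))
      (Submodule.smul_mem _ _ (commutator_mem_spanC_derived hY21 hY10)))
      (Submodule.smul_mem _ _ (commutator_mem_spanC_derived hY02 hY21)))
      (Submodule.smul_mem _ _ (commutator_mem_spanC_derived hY01 hY12)))
      (Submodule.smul_mem _ _ (commutator_mem_spanC_derived hY10 hY01)))
      (Submodule.smul_mem _ _ (commutator_mem_spanC_derived hY20 hY02)))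
      (Submodule.smul_mem _ _ (commutator_mem_spanC_derived hY10 hY02)))
      (Submodule.smul_mem _ _ (commutator_mem_spanC_derived hY20 hY01))
  · rw [hZeq w]
    simp only [Submodule.coe_add, Submodule.coe_sub, Submodule.coe_smul, hY10w, hY20w, hY01w, hY02w, hY12w, hY21w,
      LinearMap.add_apply, LinearMap.sub_apply, LinearMap.smul_apply, Module.End.mul_apply]

end HodgeStructure

end Literature.AlgebraicGeometry.Motives
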